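import Summits.Parity.GeneralizedHardyLittlewood.Theorems.PrimeLevelFamEdgeMomentsBeyondDiagonalDiagRemZeroTwoBose
import Summits.Parity.GeneralizedHardyLittlewood.Theorems.PrimeLevelFamEdgeMomentsBeyondDiagonalDiagRemInner
import HarnessLib

/-!
# Route `PrimeLevelFamEdge`, crux K_A `MomentsBeyondDiagonal` (stmt-Parity-20007), line «petersson_layers» v4, stub `stub_diag`:
# **the inner `(k₁,k₂)` sum of the ORDER-`(0,2)` remainder estimate (R₀₂), for fixed Selberg coordinates `(c,g)`**

Second brick of the order-`(0,2)` remainder estimate (R₀₂) — the hypothesis `hR` of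
`…DiagDecorOrderZeroTwoAssembly.orderZeroTwo_target_of_remainder` (p827655). The order-`(1,1)` machinery of
`…DiagRemMonomials` / `…DiagRemInner` (p827093, p827383) is re-run for the three continued
Bose remainders `r₀₀, r₀₁, r₀₂` (`r_ab(y) = c_ab(y) − Π_ab(log(1/y))`, `Π₀₀ = L/2 + E₀₀`, `Π₀₁ = −L²/8 + E₀₁`,
`Π₀₂ = L³/24 + 2μ₂L + E₀₂`, `μ₂ = ∫₀¹ log²v·v/(1+v²)²`) and the Hecke-summed remainder weight of order `(0,2)`

  `Wt₀₂(k₁,k₂) = ((L² + P₂(k₁) + P₂(k₂))/4)·r₀₀(y) + L·r₀₁(y) + r₀₂(y)`, `y = αk₁k₂`, `L = 2(log Q − log g) − log k₁ − log k₂`.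

The one observation: `Wt₀₂` IS the order-`(1,1)` weight shape of `…DiagRemMonomials.abs_profile_weight_le`
(`(L²/4 − (P2(k₁)+P2(k₂))/4)·R₀₀ + (L/2)(R₀₁+R₁₀) + R₁₁`) under `P2 ↦ −P₂`, `R₁₀ := R₀₁`, `R₁₁ := R₀₂`, so the monomial
bookkeeping is inherited verbatim.

Input: `…DiagRemZeroTwoBose.abs_doubleSum_rem_le₀₂` (the three remainders with ONE common envelope).

* `abs_inner_rem_le₀₂` — **the inner estimate**: for `n = cg ≤ M`, `Y = M/n`, `α = g²/Q²`, `2αK₁Y ≤ 1`: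
  `|Σ_{k₁,k₂≤Y} a_n(k₁)P(ℓ⁺₁/log M)a_n(k₂)P(ℓ⁺₂/log M)·Wt₀₂(k₁,k₂)| ≤ C·D(n)·Λ¹⁰(√(2αK₁Y) + (1+log K₁)⁻¹²)`,
  `Λ = 1 + 2log M + log Q` (the `P₂`-decorated COLUMN by the trivial bounds of `…DiagRemInner`).

Def-free; theorems only. Helper `--supports stmt-Parity-20007`; closes nothing (it is one brick of (R₀₂); order `(2,2)`, all
higher orders and `stub_rung/core/band/identP` remain); K_A, K_B and the Parity summit are NOT proved; nothing about
Landau–Siegel zeros.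

## References
* E. Kowalski, P. Michel, J. VanderKam, J. reine angew. Math. 526 (2000), (22)–(28) pp. 12–15 and Prop. 5.1 p. 18.
  [cite: KowalskiMichelVanderKam2000, (23)–(28) and Prop. 5.1 — derivation (order-(0,2) remainder, inner sums)]
-/

noncomputable section

open scoped Real ArithmeticFunction.Moebius
open Finset ArithmeticFunction Polynomial Real MeasureTheory

namespace Summit.Parity.GeneralizedHardyLittlewood.Theorems.MomentsBeyondDiagonal.DiagCorner

open Literature.NumberTheory.LFunctions Literature.NumberTheory.LFunctions.KMV2000
open MollifierMainTerm (W)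
open Summit.Parity.GeneralizedHardyLittlewood.Theorems.BeyondDiagonalBeatsQuarter.KernelFormXSq
  (copTauW copTauW_apply divWeight divWeight_nonneg one_le_divWeight abs_W_le)
open Summit.Parity.GeneralizedHardyLittlewood.Theorems.BeyondDiagonalBeatsQuarter.Corner
open Summit.Parity.GeneralizedHardyLittlewood.Theorems.MomentsBeyondDiagonal.DiagLines

set_option maxHeartbeats 800000 in
/-- **The inner `(k₁,k₂)` sum of the order-`(0,2)` remainder estimate (R₀₂) for fixed `(c,g)`** (see the module docstring):
for `n, g ≥ 1`, `Q, M ≥ 2`, `n, g ≤ M`, `Y = M/n`, `α = g²/Q²` and every threshold `K₁` with `2αK₁Y ≤ 1`,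
`|Σ_{k₁,k₂≤Y} a_n(k₁)P(ℓ⁺₁/log M)·a_n(k₂)P(ℓ⁺₂/log M)·Wt₀₂(k₁,k₂)| ≤ C·D(n)·(Λ¹⁰√(2αK₁Y) + Λ¹⁰/(1+log K₁)¹²)`.
[cite: KowalskiMichelVanderKam2000, (23)–(28) and Prop. 5.1 — derivation (order-(0,2) remainder, inner sums)] -/
theorem abs_inner_rem_le₀₂ : ∃ E₀₀ E₀₁ E₀₂ μ₂ : ℝ, ∀ P : ℝ[X], P.coeff 0 = 0 → ∃ C : ℝ, 0 < C ∧
    ∀ (n g : ℕ), n ≠ 0 → g ≠ 0 → ∀ (Q M : ℝ), 2 ≤ Q → 2 ≤ M → (n : ℝ) ≤ M → (g : ℝ) ≤ M → ∀ K₁ : ℕ,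
      2 * ((g : ℝ) ^ 2 / Q ^ 2) * K₁ * (M / n) ≤ 1 →
    |∑ k₁ ∈ Icc 1 ⌊M / n⌋₊, ∑ k₂ ∈ Icc 1 ⌊M / n⌋₊,
        copTauW n k₁ * P.eval (ellp (M / n) k₁ / Real.log M) * (copTauW n k₂ * P.eval (ellp (M / n) k₂ / Real.log M)) *
          ((((2 * (Real.log Q - Real.log g) - Real.log k₁ - Real.log k₂) ^ 2 +
              ((∑ p ∈ k₁.primeFactors, Real.log p ^ 2) + ∑ p ∈ k₂.primeFactors, Real.log p ^ 2)) / 4) *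
            ((∫ u₁ in Set.Ioi (0 : ℝ), ∫ u₂ in Set.Ioi (((g : ℝ) ^ 2 / Q ^ 2 * k₁ * k₂) / u₁),
                Real.exp (-(u₁ + u₂)) / (1 - Real.exp (-(u₁ + u₂))) ^ 2) -
              (Real.log (1 / ((g : ℝ) ^ 2 / Q ^ 2 * k₁ * k₂)) / 2 + E₀₀)) +
          (2 * (Real.log Q - Real.log g) - Real.log k₁ - Real.log k₂) *
            ((∫ u₁ in Set.Ioi (0 : ℝ), ∫ u₂ in Set.Ioi (((g : ℝ) ^ 2 / Q ^ 2 * k₁ * k₂) / u₁),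
                Real.exp (-(u₁ + u₂)) / (1 - Real.exp (-(u₁ + u₂))) ^ 2 * Real.log u₂) -
              (-(Real.log (1 / ((g : ℝ) ^ 2 / Q ^ 2 * k₁ * k₂)) ^ 2) / 8 + E₀₁)) +
          ((∫ u₁ in Set.Ioi (0 : ℝ), ∫ u₂ in Set.Ioi (((g : ℝ) ^ 2 / Q ^ 2 * k₁ * k₂) / u₁),
              Real.exp (-(u₁ + u₂)) / (1 - Real.exp (-(u₁ + u₂))) ^ 2 * Real.log u₂ ^ 2) -
            (Real.log (1 / ((g : ℝ) ^ 2 / Q ^ 2 * k₁ * k₂)) ^ 3 / 24 +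
              2 * μ₂ * Real.log (1 / ((g : ℝ) ^ 2 / Q ^ 2 * k₁ * k₂)) + E₀₂)))| ≤
      C * divWeight n *
        ((1 + 2 * Real.log M + Real.log Q) ^ 10 * Real.sqrt (2 * ((g : ℝ) ^ 2 / Q ^ 2) * K₁ * (M / n)) +
          (1 + 2 * Real.log M + Real.log Q) ^ 10 / (1 + Real.log K₁) ^ 12) := by
  obtain ⟨E₀₀, E₀₁, E₀₂, μ₂, C₀, hC₀, hrem⟩ := abs_doubleSum_rem_le₀₂
  obtain ⟨C₁, hC₁, hBu⟩ := abs_sum_copTauW_le'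
  obtain ⟨C₂, hC₂, hAu⟩ := abs_sum_copTauW_le
  refine ⟨E₀₀, E₀₁, E₀₂, μ₂, fun P hP0 ↦ ?_⟩
  set SP : ℝ := ∑ i ∈ Finset.range (P.natDegree + 1), |P.coeff i| with hSP
  have hSP0 : 0 ≤ SP := Finset.sum_nonneg fun i _ ↦ abs_nonneg _
  -- the final constant
  refine ⟨15 * SP ^ 2 * (3 * C₀ * (C₁ + 1) + 288 * C₀ * C₂) + 1, by positivity,
    fun n g hn hg Q M hQ2 hM2 hnM hgM K₁ hK₁ ↦ ?_⟩
  -- notation and basic facts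
  have hn0 : (0 : ℝ) < n := by exact_mod_cast Nat.pos_of_ne_zero hn
  have hg0 : (0 : ℝ) < g := by exact_mod_cast Nat.pos_of_ne_zero hg
  have hg1 : (1 : ℝ) ≤ g := by exact_mod_cast Nat.one_le_iff_ne_zero.2 hg
  have hQ0 : 0 < Q := by linarith
  have hM0 : 0 < M := by linarith
  set Y : ℝ := M / n with hYdef
  set L : ℝ := Real.log M with hLdef
  set α : ℝ := (g : ℝ) ^ 2 / Q ^ 2 with hαdef
  have hα : 0 < α := by positivity
  have hY : 1 ≤ Y := by rw [hYdef, le_div_iff₀ hn0]; linarith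
  have hY0 : 0 < Y := by linarith
  have hYM : Y ≤ M := div_le_self hM0.le (by exact_mod_cast Nat.one_le_iff_ne_zero.2 hn)
  have hL0 : 0 < L := Real.log_pos (by linarith)
  have hLY0 : 0 ≤ Real.log Y := Real.log_nonneg hY
  have hLYL : Real.log Y ≤ L := Real.log_le_log hY0 hYM
  have hlogQ : 0 ≤ Real.log Q := Real.log_nonneg (by linarith)
  have hlogg0 : 0 ≤ Real.log g := Real.log_nonneg hg1
  have hloggM : Real.log g ≤ L := Real.log_le_log hg0 hgM
  set Lam : ℝ := 1 + 2 * Real.log M + Real.log Q with hLamdef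
  have hLam1 : 1 ≤ Lam := by rw [hLamdef]; linarith
  have hLam0 : 0 < Lam := by linarith
  set β : ℝ := Real.log Q - Real.log g - Real.log Y with hβdef
  have hβ : |β| ≤ Lam := by
    rw [hβdef, hLamdef, abs_le]; constructor <;> linarith
  have hLYLam : Real.log Y ≤ Lam := by rw [hLamdef]; linarith
  have h1LY : 1 + Real.log Y ≤ Lam := by rw [hLamdef]; linarith
  have hD1 : 1 ≤ divWeight n := one_le_divWeight hn
  have hD0 : 0 ≤ divWeight n := divWeight_nonneg n
  -- `Lam' = 1 + |log(2αY²)| ≤ 2Lam`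
  have hLam' : 1 + |Real.log (2 * α * Y ^ 2)| ≤ 2 * Lam := by
    have hl2 : Real.log 2 < 1 := by have := Real.log_two_lt_d9; linarith
    have hl2' : 0 < Real.log 2 := Real.log_pos (by norm_num)
    have hlog : Real.log (2 * α * Y ^ 2) = Real.log 2 + (2 * Real.log g - 2 * Real.log Q) + 2 * Real.log Y := by
      rw [hαdef, Real.log_mul (by positivity) (by positivity), Real.log_mul (by norm_num) (by positivity),
        Real.log_pow, Real.log_div (by positivity) (by positivity), Real.log_pow, Real.log_pow]
      push_cast; ring
    rw [hlog, hLamdef]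
    have := abs_le.2 (⟨by linarith, by linarith⟩ :
      -(1 + 4 * Real.log M + 2 * Real.log Q) ≤ Real.log 2 + (2 * Real.log g - 2 * Real.log Q) + 2 * Real.log Y ∧
        Real.log 2 + (2 * Real.log g - 2 * Real.log Q) + 2 * Real.log Y ≤ 1 + 4 * Real.log M + 2 * Real.log Q)
    linarith
  have hK0 : 0 ≤ Real.log (K₁ : ℝ) := Real.log_natCast_nonneg K₁
  -- the envelope `Ψ`
  set Ψ : ℝ := divWeight n * (3 * C₀ * (C₁ + 1) * (1 + Real.log Y) ^ 8 * Real.sqrt (2 * α * K₁ * Y) +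
      18 * C₀ * C₂ * (1 + Real.log Y) ^ 4 * (1 + |Real.log (2 * α * Y ^ 2)|) ^ 4 / (1 + Real.log K₁) ^ 12)
    with hΨdef
  have hΨ0 : 0 ≤ Ψ := by rw [hΨdef]; positivity
  -- partial-sum inputs for the row sequence `a_n`
  have hηe : ∀ e : ℕ, K₁ ≤ e → |∑ k ∈ Icc 1 e, copTauW n k| ≤ C₂ * divWeight n / (1 + Real.log K₁) ^ 12 := by
    intro e he
    rcases Nat.eq_zero_or_pos e with rfl | he0
    · simp only [show Icc (1 : ℕ) 0 = ∅ from Finset.Icc_eq_empty (by norm_num), Finset.sum_empty, abs_zero]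
      positivity
    · have h := hAu n hn (e : ℝ) (by exact_mod_cast he0)
      rw [Nat.floor_natCast] at h
      refine h.trans ?_
      have hle : Real.log (K₁ : ℝ) ≤ Real.log (e : ℝ) := by
        rcases Nat.eq_zero_or_pos K₁ with rfl | hK0'
        · simp only [Nat.cast_zero, Real.log_zero]; exact Real.log_natCast_nonneg e
        · exact Real.log_le_log (by exact_mod_cast hK0') (by exact_mod_cast he)
      apply div_le_div_of_nonneg_left (by positivity) (by positivity)
      exact pow_le_pow_left₀ (by positivity) (by linarith) 12
  -- uniform bounds for the two column sequences (for `e ≤ ⌊Y⌋`)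
  have hBa : ∀ e : ℕ, e ≤ ⌊Y⌋₊ → |∑ k ∈ Icc 1 e, copTauW n k| ≤ (C₁ + 1) * divWeight n * (1 + Real.log Y) ^ 4 := by
    intro e _
    have h1 : |∑ k ∈ Icc 1 e, copTauW n k| ≤ C₁ * divWeight n := by
      rcases Nat.eq_zero_or_pos e with rfl | he
      · simp only [show Icc (1 : ℕ) 0 = ∅ from Finset.Icc_eq_empty (by norm_num), Finset.sum_empty, abs_zero]
        positivity
      · have := hBu n hn (e : ℝ) (by exact_mod_cast he)
        rwa [Nat.floor_natCast] at this
    have h4 : 1 ≤ (1 + Real.log Y) ^ 4 := one_le_pow₀ (by linarith)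
    calc _ ≤ C₁ * divWeight n := h1
      _ ≤ (C₁ + 1) * divWeight n * 1 := by nlinarith
      _ ≤ (C₁ + 1) * divWeight n * (1 + Real.log Y) ^ 4 := by gcongr
  have hBaP : ∀ e : ℕ, e ≤ ⌊Y⌋₊ → |∑ k ∈ Icc 1 e, copTauW n k * -(∑ p ∈ k.primeFactors, Real.log p ^ 2)| ≤
      (C₁ + 1) * divWeight n * (1 + Real.log Y) ^ 4 := by
    intro e he
    simp only [mul_neg, Finset.sum_neg_distrib, abs_neg]
    refine (abs_sum_copTauW_primeSq_le n hY he).trans ?_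
    have : 1 ≤ (C₁ + 1) * divWeight n := by nlinarith
    have h4 : 0 ≤ (1 + Real.log Y) ^ 4 := by positivity
    nlinarith
  -- the per-monomial bound `hR` (three remainders)
  have hR3 : ∀ R : ℝ → ℝ,
      (R = (fun y ↦ (∫ u₁ in Set.Ioi (0 : ℝ), ∫ u₂ in Set.Ioi (y / u₁),
          Real.exp (-(u₁ + u₂)) / (1 - Real.exp (-(u₁ + u₂))) ^ 2) - (Real.log (1 / y) / 2 + E₀₀)) ∨
       R = (fun y ↦ (∫ u₁ in Set.Ioi (0 : ℝ), ∫ u₂ in Set.Ioi (y / u₁),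
          Real.exp (-(u₁ + u₂)) / (1 - Real.exp (-(u₁ + u₂))) ^ 2 * Real.log u₂) -
            (-(Real.log (1 / y) ^ 2) / 8 + E₀₁)) ∨
       R = (fun y ↦ (∫ u₁ in Set.Ioi (0 : ℝ), ∫ u₂ in Set.Ioi (y / u₁),
          Real.exp (-(u₁ + u₂)) / (1 - Real.exp (-(u₁ + u₂))) ^ 2 * Real.log u₂ ^ 2) -
            (Real.log (1 / y) ^ 3 / 24 + 2 * μ₂ * Real.log (1 / y) + E₀₂))) →
      ∀ a₂ : ℕ → ℝ, (a₂ = ⇑(copTauW n) ∨ a₂ = fun k ↦ copTauW n k * -(∑ p ∈ k.primeFactors, Real.log p ^ 2)) →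
      ∀ i j : ℕ, 1 ≤ i → 1 ≤ j →
      |∑ k₁ ∈ Icc 1 ⌊Y⌋₊, ∑ k₂ ∈ Icc 1 ⌊Y⌋₊,
          copTauW n k₁ * a₂ k₂ * ellp Y k₁ ^ i * ellp Y k₂ ^ j * R (α * k₁ * k₂)| ≤ Real.log Y ^ (i + j) * Ψ := by
    intro R hRR a₂ ha₂ i j hi hj
    -- data of the column sequence
    have hcol : (∀ e : ℕ, e ≤ ⌊Y⌋₊ → |∑ k ∈ Icc 1 e, a₂ k| ≤ (C₁ + 1) * divWeight n * (1 + Real.log Y) ^ 4) ∧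
        ∑ k ∈ Icc 1 ⌊Y⌋₊, |a₂ k| * ellp Y k ^ j ≤ Real.log Y ^ j * (1 + Real.log Y) ^ 4 := by
      rcases ha₂ with rfl | rfl
      · exact ⟨hBa, sum_abs_copTauW_ellp_pow_le₄ n j hY⟩
      · refine ⟨hBaP, ?_⟩
        simp only [mul_neg, abs_neg]
        exact sum_abs_copTauW_primeSq_ellp_pow_le n j hY
    have hrow : ∑ k ∈ Icc 1 ⌊Y⌋₊, |copTauW n k| * ellp Y k ^ i ≤ Real.log Y ^ i * (1 + Real.log Y) ^ 4 :=
      sum_abs_copTauW_ellp_pow_le₄ n i hY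
    have hm := hrem (copTauW n) a₂ Y α ((C₁ + 1) * divWeight n * (1 + Real.log Y) ^ 4)
      (C₂ * divWeight n / (1 + Real.log K₁) ^ 12) K₁ i j hY hα hi hj hcol.1 hηe hK₁
    -- the common envelope evaluates to `log^{i+j}Y · Ψ`
    have henv : (∑ k ∈ Icc 1 ⌊Y⌋₊, |copTauW n k| * ellp Y k ^ i) *
          ((C₁ + 1) * divWeight n * (1 + Real.log Y) ^ 4 * (Real.log Y ^ j * (3 * C₀ * Real.sqrt (2 * α * K₁ * Y)))) +
        (∑ k ∈ Icc 1 ⌊Y⌋₊, |a₂ k| * ellp Y k ^ j) *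
          ((2 * (C₂ * divWeight n / (1 + Real.log K₁) ^ 12)) *
            (Real.log Y ^ i * (9 * C₀ * (1 + |Real.log (2 * α * Y ^ 2)|) ^ 4))) ≤ Real.log Y ^ (i + j) * Ψ := by
      have hpos1 : 0 ≤ (C₁ + 1) * divWeight n * (1 + Real.log Y) ^ 4 *
          (Real.log Y ^ j * (3 * C₀ * Real.sqrt (2 * α * K₁ * Y))) := by positivity
      have hpos2 : 0 ≤ (2 * (C₂ * divWeight n / (1 + Real.log K₁) ^ 12)) *
          (Real.log Y ^ i * (9 * C₀ * (1 + |Real.log (2 * α * Y ^ 2)|) ^ 4)) := by positivity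
      have hK12 : (0 : ℝ) < (1 + Real.log K₁) ^ 12 := by positivity
      calc _ ≤ (Real.log Y ^ i * (1 + Real.log Y) ^ 4) *
            ((C₁ + 1) * divWeight n * (1 + Real.log Y) ^ 4 * (Real.log Y ^ j * (3 * C₀ * Real.sqrt (2 * α * K₁ * Y)))) +
          (Real.log Y ^ j * (1 + Real.log Y) ^ 4) *
            ((2 * (C₂ * divWeight n / (1 + Real.log K₁) ^ 12)) *
              (Real.log Y ^ i * (9 * C₀ * (1 + |Real.log (2 * α * Y ^ 2)|) ^ 4))) :=
            add_le_add (mul_le_mul_of_nonneg_right hrow hpos1) (mul_le_mul_of_nonneg_right hcol.2 hpos2)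
        _ = Real.log Y ^ (i + j) * Ψ := by
            rw [hΨdef, pow_add]
            field_simp
            ring
    -- rewrite the remainder, then apply the estimate
    rcases hRR with rfl | rfl | rfl
    · exact (hm.1).trans henv
    · exact (hm.2.1).trans henv
    · exact (hm.2.2).trans henv
  -- the four-slot form needed by `abs_profile_weight_le` (`R₁₀ := R₀₁`, `R₁₁ := R₀₂`)
  have hR : ∀ R : ℝ → ℝ,
      (R = (fun y ↦ (∫ u₁ in Set.Ioi (0 : ℝ), ∫ u₂ in Set.Ioi (y / u₁),
          Real.exp (-(u₁ + u₂)) / (1 - Real.exp (-(u₁ + u₂))) ^ 2) - (Real.log (1 / y) / 2 + E₀₀)) ∨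
       R = (fun y ↦ (∫ u₁ in Set.Ioi (0 : ℝ), ∫ u₂ in Set.Ioi (y / u₁),
          Real.exp (-(u₁ + u₂)) / (1 - Real.exp (-(u₁ + u₂))) ^ 2 * Real.log u₂) -
            (-(Real.log (1 / y) ^ 2) / 8 + E₀₁)) ∨
       R = (fun y ↦ (∫ u₁ in Set.Ioi (0 : ℝ), ∫ u₂ in Set.Ioi (y / u₁),
          Real.exp (-(u₁ + u₂)) / (1 - Real.exp (-(u₁ + u₂))) ^ 2 * Real.log u₂) -
            (-(Real.log (1 / y) ^ 2) / 8 + E₀₁)) ∨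
       R = (fun y ↦ (∫ u₁ in Set.Ioi (0 : ℝ), ∫ u₂ in Set.Ioi (y / u₁),
          Real.exp (-(u₁ + u₂)) / (1 - Real.exp (-(u₁ + u₂))) ^ 2 * Real.log u₂ ^ 2) -
            (Real.log (1 / y) ^ 3 / 24 + 2 * μ₂ * Real.log (1 / y) + E₀₂))) →
      ∀ a₂ : ℕ → ℝ, (a₂ = ⇑(copTauW n) ∨ a₂ = fun k ↦ copTauW n k * -(∑ p ∈ k.primeFactors, Real.log p ^ 2)) →
      ∀ i j : ℕ, 1 ≤ i → 1 ≤ j →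
      |∑ k₁ ∈ Icc 1 ⌊Y⌋₊, ∑ k₂ ∈ Icc 1 ⌊Y⌋₊,
          copTauW n k₁ * a₂ k₂ * ellp Y k₁ ^ i * ellp Y k₂ ^ j * R (α * k₁ * k₂)| ≤ Real.log Y ^ (i + j) * Ψ := by
    intro R hRR
    rcases hRR with h | h | h | h
    · exact hR3 R (Or.inl h)
    · exact hR3 R (Or.inr (Or.inl h))
    · exact hR3 R (Or.inr (Or.inl h))
    · exact hR3 R (Or.inr (Or.inr h))
  -- the weight in `β`-form
  have hLk : ∀ k₁ ∈ Icc 1 ⌊Y⌋₊, ∀ k₂ ∈ Icc 1 ⌊Y⌋₊,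
      2 * (Real.log Q - Real.log g) - Real.log k₁ - Real.log k₂ = 2 * β + ellp Y k₁ + ellp Y k₂ := by
    intro k₁ hk₁ k₂ hk₂
    have h1 : (0 : ℝ) < k₁ := by exact_mod_cast (Finset.mem_Icc.1 hk₁).1
    have h2 : (0 : ℝ) < k₂ := by exact_mod_cast (Finset.mem_Icc.1 hk₂).1
    rw [ellp_eq_log hY0.le hk₁, ellp_eq_log hY0.le hk₂, Real.log_div hY0.ne' h1.ne', Real.log_div hY0.ne' h2.ne',
      hβdef]
    ring
  have key := abs_profile_weight_le P hP0 hY hLam1 hβ hLYLam hΨ0 hL0 hLYL hR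
  refine le_trans (le_of_eq ?_) (key.trans ?_)
  · congr 1
    refine Finset.sum_congr rfl fun k₁ hk₁ ↦ Finset.sum_congr rfl fun k₂ hk₂ ↦ ?_
    rw [hLk k₁ hk₁ k₂ hk₂]
    ring
  -- `15·SP²·Lam²·Ψ ≤ C·D(n)·Lam¹⁰·(√Y₁ + (1+log K₁)⁻¹²)`
  have hsq : 0 ≤ Real.sqrt (2 * α * K₁ * Y) := Real.sqrt_nonneg _
  have hK12 : (0 : ℝ) < (1 + Real.log K₁) ^ 12 := by positivity
  have h8 : (1 + Real.log Y) ^ 8 ≤ Lam ^ 8 := pow_le_pow_left₀ (by linarith) h1LY 8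
  have h4 : (1 + Real.log Y) ^ 4 ≤ Lam ^ 4 := pow_le_pow_left₀ (by linarith) h1LY 4
  have h4' : (1 + |Real.log (2 * α * Y ^ 2)|) ^ 4 ≤ (2 * Lam) ^ 4 := pow_le_pow_left₀ (by positivity) hLam' 4
  have hΨle : Ψ ≤ divWeight n * (3 * C₀ * (C₁ + 1) * Lam ^ 8 * Real.sqrt (2 * α * K₁ * Y) +
      288 * C₀ * C₂ * Lam ^ 8 / (1 + Real.log K₁) ^ 12) := by
    rw [hΨdef]
    apply mul_le_mul_of_nonneg_left _ hD0
    apply add_le_add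
    · have : 0 ≤ 3 * C₀ * (C₁ + 1) := by positivity
      exact mul_le_mul_of_nonneg_right (mul_le_mul_of_nonneg_left h8 this) hsq
    · rw [div_le_div_iff_of_pos_right hK12]
      have hLam4 : 0 ≤ Lam ^ 4 := by positivity
      calc 18 * C₀ * C₂ * (1 + Real.log Y) ^ 4 * (1 + |Real.log (2 * α * Y ^ 2)|) ^ 4
          ≤ 18 * C₀ * C₂ * Lam ^ 4 * (2 * Lam) ^ 4 := by gcongr
        _ = 288 * C₀ * C₂ * Lam ^ 8 := by ring
  have hLam2 : 0 ≤ Lam ^ 2 := by positivity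
  have hLam10 : 0 ≤ Lam ^ 10 := by positivity
  calc 15 * SP ^ 2 * Lam ^ 2 * Ψ
      ≤ 15 * SP ^ 2 * Lam ^ 2 * (divWeight n * (3 * C₀ * (C₁ + 1) * Lam ^ 8 * Real.sqrt (2 * α * K₁ * Y) +
          288 * C₀ * C₂ * Lam ^ 8 / (1 + Real.log K₁) ^ 12)) := mul_le_mul_of_nonneg_left hΨle (by positivity)
    _ = 15 * SP ^ 2 * (3 * C₀ * (C₁ + 1)) * divWeight n * (Lam ^ 10 * Real.sqrt (2 * α * K₁ * Y)) +
        15 * SP ^ 2 * (288 * C₀ * C₂) * divWeight n * (Lam ^ 10 / (1 + Real.log K₁) ^ 12) := by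
          ring
    _ ≤ (15 * SP ^ 2 * (3 * C₀ * (C₁ + 1) + 288 * C₀ * C₂) + 1) * divWeight n *
          (Lam ^ 10 * Real.sqrt (2 * α * K₁ * Y)) +
        (15 * SP ^ 2 * (3 * C₀ * (C₁ + 1) + 288 * C₀ * C₂) + 1) * divWeight n *
          (Lam ^ 10 / (1 + Real.log K₁) ^ 12) := by
          have p1 : 0 ≤ 15 * SP ^ 2 * (288 * C₀ * C₂) := by positivity
          have p2 : 0 ≤ 15 * SP ^ 2 * (3 * C₀ * (C₁ + 1)) := by positivity
          have e1 : 15 * SP ^ 2 * (3 * C₀ * (C₁ + 1)) ≤ 15 * SP ^ 2 * (3 * C₀ * (C₁ + 1) + 288 * C₀ * C₂) + 1 := by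
            linarith
          have e2 : 15 * SP ^ 2 * (288 * C₀ * C₂) ≤ 15 * SP ^ 2 * (3 * C₀ * (C₁ + 1) + 288 * C₀ * C₂) + 1 := by
            linarith
          gcongr
    _ = _ := by ring

end Summit.Parity.GeneralizedHardyLittlewood.Theorems.MomentsBeyondDiagonal.DiagCorner

end
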